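import Summits.BirchSwinnertonDyer.BirchSwinnertonDyer.Theorems.GenusKolyvaginAtTwoMinimalTwinBSDTwoKrizLiAnchor37a1
import HarnessLib

/-!
# Route `GenusKolyvaginAtTwo`, crux U₂ `MinimalTwinBSDTwo` (stmt-BirchSwinnertonDyer-22985), LINE 23 «twin_swap»: KRIZ–LI'S PRINTED SET 𝒩(37a1, ℚ(√−7)) IN THE KERNEL —
# Example 6.1 verbatim: «The set 𝒩 consists of square-free products of the signed primes −11, 53, −71, −127, 149, 197, −211, …»; the primes `11, 71, 127, 149, 197`
# are CERTIFIED in `𝒮` (`53` is in g34's `…KrizLiAnchor37a1.lean`); the positive elements `149, 197` and the PRODUCTS `781 = (−11)(−71)`, `1397 = (−11)(−127)`,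
# `9017 = (−71)(−127)` of `𝒩` (`χ_d(−37) = 1` exactly for `d > 0`, Example 6.1 (2)) give rank-one U₂-class members `37a1^{(d)}` with `BSD₂` from PRINT + MODULARITY alone

Seat `bsd-line-gk2-p2` g35 (PROVER 2/3, cell `bsd-f1-sign2`; LINE 23 holder), `--supports stmt-BirchSwinnertonDyer-22985` (helper; closes nothing).
KERNEL THEOREMS ONLY (0 `def`, 0 `sorry`); standard axioms.  HONEST FRAMING (D-0014/D-0036): a VERBATIM CHECK of print against the kernel, companion of
`…KrizLiAnchor11a1PrintedPacket.lean` (Example 6.4) for g34's PRINT-ALONE anchor `37a1` (`…KrizLiAnchor37a1.lean`, Example 6.1/6.2): certified point counts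
`#Ẽ(𝔽_ℓ) = 17, 63, 127, 155, 195` at `ℓ = 11, 71, 127, 149, 197` (`a_ℓ = −5, 9, 1, −5, 3` odd: `Frob_ℓ` of order `3` on `E[2]`), `(−7/ℓ) = 1`, so `ℓ ∈ 𝒮(37a1, K)`
(`inS_<ℓ>_37A1`) — the printed list and the kernel agree on all six signed primes up to `197`.  Since `Δ(37a1) = 37 > 0`, `χ_d(−37) = 1` iff `d > 0` (Example 6.1 (2):
«rank E^{(d)} = 1 … for d > 0»), so the rank-one members of U₂'s class covered by Thm 5.1 (2) are the `37a1^{(d)}` with `d ∈ 𝒩`, `d > 0`: the printed primes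
`149`, `197` (`N = 821437`, `1435933`) and — NEW, composite elements of `𝒩` — `781`, `1397`, `9017` (`N = 22568557`, `72209533`, `3008332693`), each
`r_an = 1 ∧ ¬CM ∧ BSDp · 2` via g34's `printFamily37A1_krizLi_rankOneMembers` (PRINT: Thm 5.1 (2)/4.3, Table-1 row, Creutz–Miller at `37` and `1813`; MODULARITY for
`r_an(37a1) = 1` via the tree's root number).  **BSD is NOT proved by any of this; U₂ is NOT proved; no item is closed.**

References: [KrizLi2019] §6 Example 6.1 (arXiv:1606.03172v3 Congruence.tex l. 949), Def 4.1, Thm 4.3 + Cor., Thm 5.1 (2); [CreutzMiller2012] Thm 1.1;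
[CremonaAlgorithms1997] Table 1 (37A1); [SilvermanAEC2009] V.2.
-/

set_option autoImplicit false
-- the Theorems namespace of this sub repeats the summit name by design (D-0017 nested layout)
set_option linter.dupNamespace false

noncomputable section

open scoped Classical

open WeierstrassCurve NumberField Literature.NumberTheory.EllipticCurves
  Literature.NumberTheory.EllipticCurves.ModularForms
  Literature.NumberTheory.EllipticCurves.Rank1Residual
  Literature.NumberTheory.EllipticCurves.Rank1Residual.Typed
  Literature.NumberTheory.EllipticCurves.Curve37a
  Summit.BirchSwinnertonDyer.Rank1Residual
  Summit.BirchSwinnertonDyer.Rank1Residual.P2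
  Summit.BirchSwinnertonDyer.BirchSwinnertonDyer.Theorems.AddPotGoodPrint

namespace Summit.BirchSwinnertonDyer.BirchSwinnertonDyer.Theorems.GenusExact.TwinSwap.KrizLiAnchor37a1

/-- **`#Ẽ(𝔽_11) = 17` for `37a1`** (certified count), so `a_11 = -5`. [cite: KrizLi2019, §6 Example 6.1 (the signed prime -11 of 𝒩)] [cite: SilvermanAEC2009, V.2] -/
theorem reductionPointCount_11_37A1 :
    haveI := isGloballyMinimal_37A1
    E.reductionPointCount 11 = 17 := by
  haveI : Fact (Nat.Prime 11) := ⟨by norm_num⟩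
  haveI := isGloballyMinimal_37A1
  exact Supersingular.reductionPointCount_eq_of_intModel_countPoints intModel_37A1 11 (by norm_num) (by decide +kernel)
    (by decide +kernel)

/-- **`a_11(37a1) = -5` is odd**, so `11 ∈ 𝒮(37a1, ℚ(√−7))` once `(−7/11) = 1` is read. [cite: KrizLi2019, Def. 4.1 and §6 Example 6.1] -/
theorem odd_frobeniusTrace_11_37A1 :
    haveI := isGloballyMinimal_37A1
    Odd (E.frobeniusTrace 11) := by
  haveI := isGloballyMinimal_37A1
  rw [Uniform.U2.odd_frobeniusTrace_iff_odd_reductionPointCount _ (by norm_num : Nat.Prime 11) (by norm_num),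
    reductionPointCount_11_37A1]
  decide

/-- **`11 ∈ 𝒮(37a1, K)`** (`d_K = −7`): the signed prime `-11` of Kriz–Li's printed list. [cite: KrizLi2019, §6 Example 6.1 ("signed primes −11, 53, −71, −127, 149, 197, …")] -/
theorem inS_11_37A1 {K : Type} [Field K] [NumberField K] (h2 : Module.finrank ℚ K = 2) (hdK : NumberField.discr K = -7) :
    haveI := isGloballyMinimal_37A1
    KrizLi2019.InS E K 11 :=
  inS_37A1 h2 hdK (by norm_num) (by norm_num) (by norm_num) (by norm_num) odd_frobeniusTrace_11_37A1

/-- **`#Ẽ(𝔽_71) = 63` for `37a1`** (certified count), so `a_71 = 9`. [cite: KrizLi2019, §6 Example 6.1 (the signed prime -71 of 𝒩)] [cite: SilvermanAEC2009, V.2] -/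
theorem reductionPointCount_71_37A1 :
    haveI := isGloballyMinimal_37A1
    E.reductionPointCount 71 = 63 := by
  haveI : Fact (Nat.Prime 71) := ⟨by norm_num⟩
  haveI := isGloballyMinimal_37A1
  exact Supersingular.reductionPointCount_eq_of_intModel_countPoints intModel_37A1 71 (by norm_num) (by decide +kernel)
    (by decide +kernel)

/-- **`a_71(37a1) = 9` is odd**, so `71 ∈ 𝒮(37a1, ℚ(√−7))` once `(−7/71) = 1` is read. [cite: KrizLi2019, Def. 4.1 and §6 Example 6.1] -/
theorem odd_frobeniusTrace_71_37A1 :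
    haveI := isGloballyMinimal_37A1
    Odd (E.frobeniusTrace 71) := by
  haveI := isGloballyMinimal_37A1
  rw [Uniform.U2.odd_frobeniusTrace_iff_odd_reductionPointCount _ (by norm_num : Nat.Prime 71) (by norm_num),
    reductionPointCount_71_37A1]
  decide

/-- **`71 ∈ 𝒮(37a1, K)`** (`d_K = −7`): the signed prime `-71` of Kriz–Li's printed list. [cite: KrizLi2019, §6 Example 6.1 ("signed primes −11, 53, −71, −127, 149, 197, …")] -/
theorem inS_71_37A1 {K : Type} [Field K] [NumberField K] (h2 : Module.finrank ℚ K = 2) (hdK : NumberField.discr K = -7) :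
    haveI := isGloballyMinimal_37A1
    KrizLi2019.InS E K 71 :=
  inS_37A1 h2 hdK (by norm_num) (by norm_num) (by norm_num) (by norm_num) odd_frobeniusTrace_71_37A1

/-- **`#Ẽ(𝔽_127) = 127` for `37a1`** (certified count), so `a_127 = 1`. [cite: KrizLi2019, §6 Example 6.1 (the signed prime -127 of 𝒩)] [cite: SilvermanAEC2009, V.2] -/
theorem reductionPointCount_127_37A1 :
    haveI := isGloballyMinimal_37A1
    E.reductionPointCount 127 = 127 := by
  haveI : Fact (Nat.Prime 127) := ⟨by norm_num⟩
  haveI := isGloballyMinimal_37A1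
  exact Supersingular.reductionPointCount_eq_of_intModel_countPoints intModel_37A1 127 (by norm_num) (by decide +kernel)
    (by decide +kernel)

/-- **`a_127(37a1) = 1` is odd**, so `127 ∈ 𝒮(37a1, ℚ(√−7))` once `(−7/127) = 1` is read. [cite: KrizLi2019, Def. 4.1 and §6 Example 6.1] -/
theorem odd_frobeniusTrace_127_37A1 :
    haveI := isGloballyMinimal_37A1
    Odd (E.frobeniusTrace 127) := by
  haveI := isGloballyMinimal_37A1
  rw [Uniform.U2.odd_frobeniusTrace_iff_odd_reductionPointCount _ (by norm_num : Nat.Prime 127) (by norm_num),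
    reductionPointCount_127_37A1]
  decide

/-- **`127 ∈ 𝒮(37a1, K)`** (`d_K = −7`): the signed prime `-127` of Kriz–Li's printed list. [cite: KrizLi2019, §6 Example 6.1 ("signed primes −11, 53, −71, −127, 149, 197, …")] -/
theorem inS_127_37A1 {K : Type} [Field K] [NumberField K] (h2 : Module.finrank ℚ K = 2) (hdK : NumberField.discr K = -7) :
    haveI := isGloballyMinimal_37A1
    KrizLi2019.InS E K 127 :=
  inS_37A1 h2 hdK (by norm_num) (by norm_num) (by norm_num) (by norm_num) odd_frobeniusTrace_127_37A1

/-- **`#Ẽ(𝔽_149) = 155` for `37a1`** (certified count), so `a_149 = -5`. [cite: KrizLi2019, §6 Example 6.1 (the signed prime 149 of 𝒩)] [cite: SilvermanAEC2009, V.2] -/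
theorem reductionPointCount_149_37A1 :
    haveI := isGloballyMinimal_37A1
    E.reductionPointCount 149 = 155 := by
  haveI : Fact (Nat.Prime 149) := ⟨by norm_num⟩
  haveI := isGloballyMinimal_37A1
  exact Supersingular.reductionPointCount_eq_of_intModel_countPoints intModel_37A1 149 (by norm_num) (by decide +kernel)
    (by decide +kernel)

/-- **`a_149(37a1) = -5` is odd**, so `149 ∈ 𝒮(37a1, ℚ(√−7))` once `(−7/149) = 1` is read. [cite: KrizLi2019, Def. 4.1 and §6 Example 6.1] -/
theorem odd_frobeniusTrace_149_37A1 :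
    haveI := isGloballyMinimal_37A1
    Odd (E.frobeniusTrace 149) := by
  haveI := isGloballyMinimal_37A1
  rw [Uniform.U2.odd_frobeniusTrace_iff_odd_reductionPointCount _ (by norm_num : Nat.Prime 149) (by norm_num),
    reductionPointCount_149_37A1]
  decide

/-- **`149 ∈ 𝒮(37a1, K)`** (`d_K = −7`): the signed prime `149` of Kriz–Li's printed list. [cite: KrizLi2019, §6 Example 6.1 ("signed primes −11, 53, −71, −127, 149, 197, …")] -/
theorem inS_149_37A1 {K : Type} [Field K] [NumberField K] (h2 : Module.finrank ℚ K = 2) (hdK : NumberField.discr K = -7) :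
    haveI := isGloballyMinimal_37A1
    KrizLi2019.InS E K 149 :=
  inS_37A1 h2 hdK (by norm_num) (by norm_num) (by norm_num) (by norm_num) odd_frobeniusTrace_149_37A1

/-- **`#Ẽ(𝔽_197) = 195` for `37a1`** (certified count), so `a_197 = 3`. [cite: KrizLi2019, §6 Example 6.1 (the signed prime 197 of 𝒩)] [cite: SilvermanAEC2009, V.2] -/
theorem reductionPointCount_197_37A1 :
    haveI := isGloballyMinimal_37A1
    E.reductionPointCount 197 = 195 := by
  haveI : Fact (Nat.Prime 197) := ⟨by norm_num⟩
  haveI := isGloballyMinimal_37A1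
  exact Supersingular.reductionPointCount_eq_of_intModel_countPoints intModel_37A1 197 (by norm_num) (by decide +kernel)
    (by decide +kernel)

/-- **`a_197(37a1) = 3` is odd**, so `197 ∈ 𝒮(37a1, ℚ(√−7))` once `(−7/197) = 1` is read. [cite: KrizLi2019, Def. 4.1 and §6 Example 6.1] -/
theorem odd_frobeniusTrace_197_37A1 :
    haveI := isGloballyMinimal_37A1
    Odd (E.frobeniusTrace 197) := by
  haveI := isGloballyMinimal_37A1
  rw [Uniform.U2.odd_frobeniusTrace_iff_odd_reductionPointCount _ (by norm_num : Nat.Prime 197) (by norm_num),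
    reductionPointCount_197_37A1]
  decide

/-- **`197 ∈ 𝒮(37a1, K)`** (`d_K = −7`): the signed prime `197` of Kriz–Li's printed list. [cite: KrizLi2019, §6 Example 6.1 ("signed primes −11, 53, −71, −127, 149, 197, …")] -/
theorem inS_197_37A1 {K : Type} [Field K] [NumberField K] (h2 : Module.finrank ℚ K = 2) (hdK : NumberField.discr K = -7) :
    haveI := isGloballyMinimal_37A1
    KrizLi2019.InS E K 197 :=
  inS_37A1 h2 hdK (by norm_num) (by norm_num) (by norm_num) (by norm_num) odd_frobeniusTrace_197_37A1

/-- **`149 ∈ 𝒩(37a1, K)`** (`d_K = −7`): the printed signed prime `149 ≡ 1 (mod 4)`. [cite: KrizLi2019, Def. 4.1 and §6 Example 6.1] -/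
theorem inN_149_37A1 {K : Type} [Field K] [NumberField K] (h2 : Module.finrank ℚ K = 2) (hdK : NumberField.discr K = -7) :
    haveI := isGloballyMinimal_37A1
    KrizLi2019.InN E K 149 := by
  haveI := isGloballyMinimal_37A1
  have hw : Nat.Prime 149 := by norm_num
  have hna : (149 : ℤ).natAbs = 149 := rfl
  refine ⟨by decide, by rw [hna]; exact hw.squarefree, fun ℓ hℓ hℓd => ?_⟩
  rw [hna] at hℓd
  obtain rfl := (Nat.prime_dvd_prime_iff_eq hℓ hw).mp hℓd
  exact inS_149_37A1 h2 hdK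

/-- **`χ_{149}(−37) = 1`** (`d > 0`: Example 6.1 (2), `Δ(37a1) > 0`), read with `N = 37` exact. [cite: KrizLi2019, Thm. 5.1 (2) and §6 Example 6.1 (2)] -/
theorem sign_149_37A1 : Int.sign 149 * jacobiSym (E.conductorNorm ℤ) (149 : ℤ).natAbs = 1 := by
  rw [conductorNorm_E, show (149 : ℤ).natAbs = 149 from rfl]; norm_num

/-- **The rank-one member `37a1^{(149)}`** (`N = 37·149² = 821437`): `r_an = 1 ∧ ¬CM ∧ BSD(·, 2)` at every global minimal model, from PRINT + MODULARITY alone.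
BSD is not proved by any of this. [cite: KrizLi2019, §6 Example 6.1 (4) and Thm. 5.1 (2)] [cite: CreutzMiller2012, Thm. 1.1] -/
theorem printFamily37A1_krizLi_witness149 (hKL : KrizLi2019.thm112_bsdTwo_twist) (h33 : KrizLi2019.thm33_rank_twist)
    (htab : KrizLi2019.table1_row37a1) (hS31 : bsdTriple_of_analyticRank_le_one_of_conductor_lt) (hmod : exists_isNewformOf)
    (K : Type) [Field K] [NumberField K] (hK : IsImaginaryQuadratic K) (hdK : NumberField.discr K = -7)
    (W₁ : WeierstrassCurve ℚ) [W₁.IsElliptic] [W₁.IsGloballyMinimal]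
    (hW₁ : ∃ C : VariableChange ℚ, C • E.quadraticTwist ((149 : ℤ) : ℚ) = W₁) :
    W₁.analyticRank = 1 ∧ ¬ W₁.HasCM ∧ BSDp W₁ 2 :=
  printFamily37A1_krizLi_rankOneMembers hKL h33 htab hS31 hmod K hK hdK (inN_149_37A1 hK.1 hdK) sign_149_37A1 W₁ hW₁

/-- **`197 ∈ 𝒩(37a1, K)`** (`d_K = −7`): the printed signed prime `197 ≡ 1 (mod 4)`. [cite: KrizLi2019, Def. 4.1 and §6 Example 6.1] -/
theorem inN_197_37A1 {K : Type} [Field K] [NumberField K] (h2 : Module.finrank ℚ K = 2) (hdK : NumberField.discr K = -7) :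
    haveI := isGloballyMinimal_37A1
    KrizLi2019.InN E K 197 := by
  haveI := isGloballyMinimal_37A1
  have hw : Nat.Prime 197 := by norm_num
  have hna : (197 : ℤ).natAbs = 197 := rfl
  refine ⟨by decide, by rw [hna]; exact hw.squarefree, fun ℓ hℓ hℓd => ?_⟩
  rw [hna] at hℓd
  obtain rfl := (Nat.prime_dvd_prime_iff_eq hℓ hw).mp hℓd
  exact inS_197_37A1 h2 hdK

/-- **`χ_{197}(−37) = 1`** (`d > 0`: Example 6.1 (2), `Δ(37a1) > 0`), read with `N = 37` exact. [cite: KrizLi2019, Thm. 5.1 (2) and §6 Example 6.1 (2)] -/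
theorem sign_197_37A1 : Int.sign 197 * jacobiSym (E.conductorNorm ℤ) (197 : ℤ).natAbs = 1 := by
  rw [conductorNorm_E, show (197 : ℤ).natAbs = 197 from rfl]; norm_num

/-- **The rank-one member `37a1^{(197)}`** (`N = 37·197² = 1435933`): `r_an = 1 ∧ ¬CM ∧ BSD(·, 2)` at every global minimal model, from PRINT + MODULARITY alone.
BSD is not proved by any of this. [cite: KrizLi2019, §6 Example 6.1 (4) and Thm. 5.1 (2)] [cite: CreutzMiller2012, Thm. 1.1] -/
theorem printFamily37A1_krizLi_witness197 (hKL : KrizLi2019.thm112_bsdTwo_twist) (h33 : KrizLi2019.thm33_rank_twist)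
    (htab : KrizLi2019.table1_row37a1) (hS31 : bsdTriple_of_analyticRank_le_one_of_conductor_lt) (hmod : exists_isNewformOf)
    (K : Type) [Field K] [NumberField K] (hK : IsImaginaryQuadratic K) (hdK : NumberField.discr K = -7)
    (W₁ : WeierstrassCurve ℚ) [W₁.IsElliptic] [W₁.IsGloballyMinimal]
    (hW₁ : ∃ C : VariableChange ℚ, C • E.quadraticTwist ((197 : ℤ) : ℚ) = W₁) :
    W₁.analyticRank = 1 ∧ ¬ W₁.HasCM ∧ BSDp W₁ 2 :=
  printFamily37A1_krizLi_rankOneMembers hKL h33 htab hS31 hmod K hK hdK (inN_197_37A1 hK.1 hdK) sign_197_37A1 W₁ hW₁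

/-- **`781 = (−11)·(−71) ∈ 𝒩(37a1, K)`** (`d_K = −7`): a square-free product of two printed signed primes, `781 ≡ 1 (mod 4)`.
[cite: KrizLi2019, Def. 4.1 and §6 Example 6.1 ("𝒩 consists of square-free products of the signed primes …")] -/
theorem inN_781_37A1 {K : Type} [Field K] [NumberField K] (h2 : Module.finrank ℚ K = 2) (hdK : NumberField.discr K = -7) :
    haveI := isGloballyMinimal_37A1
    KrizLi2019.InN E K 781 := by
  haveI := isGloballyMinimal_37A1
  have hp : Nat.Prime 11 := by norm_num
  have hq : Nat.Prime 71 := by norm_num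
  have hna : (781 : ℤ).natAbs = 11 * 71 := rfl
  refine ⟨by decide, ?_, fun ℓ hℓ hℓd => ?_⟩
  · rw [hna, Nat.squarefree_mul_iff]
    exact ⟨by norm_num, hp.squarefree, hq.squarefree⟩
  · rw [hna] at hℓd
    rcases (Nat.Prime.dvd_mul hℓ).mp hℓd with h | h
    · obtain rfl := (Nat.prime_dvd_prime_iff_eq hℓ hp).mp h
      exact inS_11_37A1 h2 hdK
    · obtain rfl := (Nat.prime_dvd_prime_iff_eq hℓ hq).mp h
      exact inS_71_37A1 h2 hdK

/-- **`χ_{781}(−37) = 1`** (`d = 781 > 0`), read with `N = 37` exact. [cite: KrizLi2019, Thm. 5.1 (2) and §6 Example 6.1 (2)] -/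
theorem sign_781_37A1 : Int.sign 781 * jacobiSym (E.conductorNorm ℤ) (781 : ℤ).natAbs = 1 := by
  rw [conductorNorm_E, show (781 : ℤ).natAbs = 781 from rfl]; norm_num

/-- **The rank-one member `37a1^{(781)}`** (`N = 37·781² = 22568557`): `r_an = 1 ∧ ¬CM ∧ BSD(·, 2)` at every global minimal model, from PRINT + MODULARITY alone
(a COMPOSITE element of the printed `𝒩`). BSD is not proved by any of this. [cite: KrizLi2019, §6 Example 6.1 (4) and Thm. 5.1 (2)] [cite: CreutzMiller2012, Thm. 1.1] -/
theorem printFamily37A1_krizLi_witness781 (hKL : KrizLi2019.thm112_bsdTwo_twist) (h33 : KrizLi2019.thm33_rank_twist)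
    (htab : KrizLi2019.table1_row37a1) (hS31 : bsdTriple_of_analyticRank_le_one_of_conductor_lt) (hmod : exists_isNewformOf)
    (K : Type) [Field K] [NumberField K] (hK : IsImaginaryQuadratic K) (hdK : NumberField.discr K = -7)
    (W₁ : WeierstrassCurve ℚ) [W₁.IsElliptic] [W₁.IsGloballyMinimal]
    (hW₁ : ∃ C : VariableChange ℚ, C • E.quadraticTwist ((781 : ℤ) : ℚ) = W₁) :
    W₁.analyticRank = 1 ∧ ¬ W₁.HasCM ∧ BSDp W₁ 2 :=
  printFamily37A1_krizLi_rankOneMembers hKL h33 htab hS31 hmod K hK hdK (inN_781_37A1 hK.1 hdK) sign_781_37A1 W₁ hW₁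

/-- **`1397 = (−11)·(−127) ∈ 𝒩(37a1, K)`** (`d_K = −7`): a square-free product of two printed signed primes, `1397 ≡ 1 (mod 4)`.
[cite: KrizLi2019, Def. 4.1 and §6 Example 6.1 ("𝒩 consists of square-free products of the signed primes …")] -/
theorem inN_1397_37A1 {K : Type} [Field K] [NumberField K] (h2 : Module.finrank ℚ K = 2) (hdK : NumberField.discr K = -7) :
    haveI := isGloballyMinimal_37A1
    KrizLi2019.InN E K 1397 := by
  haveI := isGloballyMinimal_37A1
  have hp : Nat.Prime 11 := by norm_num
  have hq : Nat.Prime 127 := by norm_num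
  have hna : (1397 : ℤ).natAbs = 11 * 127 := rfl
  refine ⟨by decide, ?_, fun ℓ hℓ hℓd => ?_⟩
  · rw [hna, Nat.squarefree_mul_iff]
    exact ⟨by norm_num, hp.squarefree, hq.squarefree⟩
  · rw [hna] at hℓd
    rcases (Nat.Prime.dvd_mul hℓ).mp hℓd with h | h
    · obtain rfl := (Nat.prime_dvd_prime_iff_eq hℓ hp).mp h
      exact inS_11_37A1 h2 hdK
    · obtain rfl := (Nat.prime_dvd_prime_iff_eq hℓ hq).mp h
      exact inS_127_37A1 h2 hdK

/-- **`χ_{1397}(−37) = 1`** (`d = 1397 > 0`), read with `N = 37` exact. [cite: KrizLi2019, Thm. 5.1 (2) and §6 Example 6.1 (2)] -/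
theorem sign_1397_37A1 : Int.sign 1397 * jacobiSym (E.conductorNorm ℤ) (1397 : ℤ).natAbs = 1 := by
  rw [conductorNorm_E, show (1397 : ℤ).natAbs = 1397 from rfl]; norm_num

/-- **The rank-one member `37a1^{(1397)}`** (`N = 37·1397² = 72209533`): `r_an = 1 ∧ ¬CM ∧ BSD(·, 2)` at every global minimal model, from PRINT + MODULARITY alone
(a COMPOSITE element of the printed `𝒩`). BSD is not proved by any of this. [cite: KrizLi2019, §6 Example 6.1 (4) and Thm. 5.1 (2)] [cite: CreutzMiller2012, Thm. 1.1] -/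
theorem printFamily37A1_krizLi_witness1397 (hKL : KrizLi2019.thm112_bsdTwo_twist) (h33 : KrizLi2019.thm33_rank_twist)
    (htab : KrizLi2019.table1_row37a1) (hS31 : bsdTriple_of_analyticRank_le_one_of_conductor_lt) (hmod : exists_isNewformOf)
    (K : Type) [Field K] [NumberField K] (hK : IsImaginaryQuadratic K) (hdK : NumberField.discr K = -7)
    (W₁ : WeierstrassCurve ℚ) [W₁.IsElliptic] [W₁.IsGloballyMinimal]
    (hW₁ : ∃ C : VariableChange ℚ, C • E.quadraticTwist ((1397 : ℤ) : ℚ) = W₁) :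
    W₁.analyticRank = 1 ∧ ¬ W₁.HasCM ∧ BSDp W₁ 2 :=
  printFamily37A1_krizLi_rankOneMembers hKL h33 htab hS31 hmod K hK hdK (inN_1397_37A1 hK.1 hdK) sign_1397_37A1 W₁ hW₁

/-- **`9017 = (−71)·(−127) ∈ 𝒩(37a1, K)`** (`d_K = −7`): a square-free product of two printed signed primes, `9017 ≡ 1 (mod 4)`.
[cite: KrizLi2019, Def. 4.1 and §6 Example 6.1 ("𝒩 consists of square-free products of the signed primes …")] -/
theorem inN_9017_37A1 {K : Type} [Field K] [NumberField K] (h2 : Module.finrank ℚ K = 2) (hdK : NumberField.discr K = -7) :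
    haveI := isGloballyMinimal_37A1
    KrizLi2019.InN E K 9017 := by
  haveI := isGloballyMinimal_37A1
  have hp : Nat.Prime 71 := by norm_num
  have hq : Nat.Prime 127 := by norm_num
  have hna : (9017 : ℤ).natAbs = 71 * 127 := rfl
  refine ⟨by decide, ?_, fun ℓ hℓ hℓd => ?_⟩
  · rw [hna, Nat.squarefree_mul_iff]
    exact ⟨by norm_num, hp.squarefree, hq.squarefree⟩
  · rw [hna] at hℓd
    rcases (Nat.Prime.dvd_mul hℓ).mp hℓd with h | h
    · obtain rfl := (Nat.prime_dvd_prime_iff_eq hℓ hp).mp h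
      exact inS_71_37A1 h2 hdK
    · obtain rfl := (Nat.prime_dvd_prime_iff_eq hℓ hq).mp h
      exact inS_127_37A1 h2 hdK

/-- **`χ_{9017}(−37) = 1`** (`d = 9017 > 0`), read with `N = 37` exact. [cite: KrizLi2019, Thm. 5.1 (2) and §6 Example 6.1 (2)] -/
theorem sign_9017_37A1 : Int.sign 9017 * jacobiSym (E.conductorNorm ℤ) (9017 : ℤ).natAbs = 1 := by
  rw [conductorNorm_E, show (9017 : ℤ).natAbs = 9017 from rfl]; norm_num

/-- **The rank-one member `37a1^{(9017)}`** (`N = 37·9017² = 3008332693`): `r_an = 1 ∧ ¬CM ∧ BSD(·, 2)` at every global minimal model, from PRINT + MODULARITY alone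
(a COMPOSITE element of the printed `𝒩`). BSD is not proved by any of this. [cite: KrizLi2019, §6 Example 6.1 (4) and Thm. 5.1 (2)] [cite: CreutzMiller2012, Thm. 1.1] -/
theorem printFamily37A1_krizLi_witness9017 (hKL : KrizLi2019.thm112_bsdTwo_twist) (h33 : KrizLi2019.thm33_rank_twist)
    (htab : KrizLi2019.table1_row37a1) (hS31 : bsdTriple_of_analyticRank_le_one_of_conductor_lt) (hmod : exists_isNewformOf)
    (K : Type) [Field K] [NumberField K] (hK : IsImaginaryQuadratic K) (hdK : NumberField.discr K = -7)
    (W₁ : WeierstrassCurve ℚ) [W₁.IsElliptic] [W₁.IsGloballyMinimal]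
    (hW₁ : ∃ C : VariableChange ℚ, C • E.quadraticTwist ((9017 : ℤ) : ℚ) = W₁) :
    W₁.analyticRank = 1 ∧ ¬ W₁.HasCM ∧ BSDp W₁ 2 :=
  printFamily37A1_krizLi_rankOneMembers hKL h33 htab hS31 hmod K hK hdK (inN_9017_37A1 hK.1 hdK) sign_9017_37A1 W₁ hW₁

end Summit.BirchSwinnertonDyer.BirchSwinnertonDyer.Theorems.GenusExact.TwinSwap.KrizLiAnchor37a1

end
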